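import Literature.NumberTheory.EllipticCurves.XCubeAddDXSharpRankSha
import Literature.NumberTheory.EllipticCurves.XCubeSub82XRankThree
import Literature.NumberTheory.EllipticCurves.SelmerCorankHolds
import Literature.NumberTheory.EllipticCurves.ComplexMultiplicationRationalJIntegralProofs

/-!
# BirchSwinnertonDyer / ShaPrimaryTransfer — crux `FiniteShaComponentTransfer` (stmt-BirchSwinnertonDyer-22356):
# a NON-CM elliptic curve of rank 4 with `Ш[2] = 0` — `W : y² = x³ + x² − 73201x` — by complete `2`-isogeny descent

Route `ShaPrimaryTransfer` (D-0145 LINE 2): T = `FiniteShaComponentTransfer`, its door at `2` decided by complete `2`-descent.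
The companions certify the door in the kernel at ranks `0–7` on curves `y² = x³ + Dx` (all CM, `j = 1728`) and, outside the CM
sector, at rank `3` (`…NonCMRankThreeDoor`: `y² = x³ + x² − 340x`). Since the cell's question (F1-sign2) and the printed
`2`-converses concern NON-CM curves, this helper file (prover seat `bsd-line-spt-p1` g5, `--supports stmt-22356 --as helper`;
route-independent) runs the descent on a NON-CM curve of rank `4`:

  `W : y² = x³ + x² − 73201x` (`E_{a,b}`, `a = 1`, `b = −73201 = −71·1031`; `b' = a² − 4b = 292805 = 5·157·373`;
  `W' : y² = x³ − 2x² + 292805x`; `j(W) = 2⁸·(2²·7·11·23·31)³/(71²·1031²·5·157·373) ∉ ℤ`).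

In the tree's currency (Silverman–Tate §3.5–3.6 / AEC X.4.9): the points `(−64, 2104)`, `(−71, 2201)`, `(1031, 31961)` of `W`
give `α = [−1], [−71], [1031]` (six classes with `[1], [71], [−1031]`), the points `(5, 1210)`, `(2512, 128740)`, `(373, 12682)`
of `W'` give `ᾱ = [5], [157], [373]` (five classes with `[1], [785]`); as `#α · #ᾱ = 2^{rank+2}` both are powers of `2`, hence
`≥ 8`, so `2^{rank+2} ≥ 2⁶`; and `rank + 2 ≤ dim₂ S(1,−73201) + dim₂ S(−2,292805) ≤ (ν(73201) + 1) + ν(292805) = 6`. Therefore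
**`rank W(ℚ) = 4`** (`mordellWeilRank_eq_four`), the descent is sharp, **`Ш(W/ℚ)[2] = 0`** (`forall_mem_sha_two_smul_eq_zero`, tree
`forall_mem_sha_two_smul_eq_zero_of_selmerRank_add_le`), `t_2(W) = 0` and `corank Sel_{2^∞}(W) = 4` (`door_at_two_rank_four`,
`selmerCorank_two_eq_four`), O for `W`; and **`¬ W.HasCM`** (`not_hasCM`: `j(W) ∉ ℤ`, CM `j`-invariants being integral, tree theorem
`exists_intCast_eq_j_of_hasCM`). Everything UNCONDITIONAL (standard axioms, no named fact). Nothing here proves T, O or BSD; T is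
conjecture-grade at rank ≥ 2. References: J. H. Silverman, *AEC* 2nd ed., X.4.7, X.4.9; J. H. Silverman, J. Tate, *Rational Points
on Elliptic Curves*, §3.5–3.6; J. H. Silverman, *ATAEC*, II.6.1; R. Greenberg, LNM 1716 (1999), §1.
-/

-- D-0017: single-problem summit, so `Summit.BirchSwinnertonDyer.BirchSwinnertonDyer.…` repeats a namespace BY DESIGN.
set_option linter.dupNamespace false

noncomputable section

namespace Summit.BirchSwinnertonDyer.BirchSwinnertonDyer.Theorems.ShaPrimaryTransferNonCMRankFour

open scoped Classical
open Literature.NumberTheory.EllipticCurves Literature.NumberTheory.EllipticCurves.XCubeAddDX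
open WeierstrassCurve WeierstrassCurve.Affine

/-! ## §0 Bookkeeping -/

/-- `b(a² − 4b) ≠ 0` for `(a, b) = (1, −73201)` (`a² − 4b = 292805`). [folklore] -/
private theorem hab : (-73201 : ℤ) * ((1 : ℤ) ^ 2 - 4 * (-73201)) ≠ 0 := by norm_num

/-- The tree's literal `E_{1,−73201}` is `⟨0, 1, 0, −73201, 0⟩`. [folklore] -/
private theorem lit_W : (⟨0, ((1 : ℤ) : ℚ), 0, ((-73201 : ℤ) : ℚ), 0⟩ : WeierstrassCurve ℚ) = ⟨0, 1, 0, -73201, 0⟩ := by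
  ext <;> push_cast <;> ring

/-- The tree's literal `E'_{1,−73201} = E_{−2, 292805}` is `⟨0, −2, 0, 292805, 0⟩`. [folklore] -/
private theorem lit_W' :
    (⟨0, ((-2 * 1 : ℤ) : ℚ), 0, (((1 : ℤ) ^ 2 - 4 * (-73201) : ℤ) : ℚ), 0⟩ : WeierstrassCurve ℚ) = ⟨0, -2, 0, 292805, 0⟩ := by
  ext <;> push_cast <;> ring

/-- `W : y² = x³ + x² − 73201x` is an elliptic curve. [folklore] -/
theorem isElliptic_W : (⟨0, 1, 0, -73201, 0⟩ : WeierstrassCurve ℚ).IsElliptic := by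
  rw [← lit_W]; exact isElliptic_mk_of_ne_zero (F := ℚ) hab

/-- `W' : y² = x³ − 2x² + 292805x` is an elliptic curve. [folklore] -/
theorem isElliptic_W' : (⟨0, -2, 0, 292805, 0⟩ : WeierstrassCurve ℚ).IsElliptic := by
  rw [← lit_W']; exact isElliptic_mk_of_ne_zero (F := ℚ) (twoIsogenyCodomain_ne_zero hab)

/-- Squarefree integers with the same class in `ℚ*/ℚ*²` are equal. [folklore] -/
private theorem eq_of_sqClass_intCast_eq {d₁ d₂ : ℤ} (h₁ : Squarefree d₁) (h₂ : Squarefree d₂)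
    (he : sqClass (d₁ : ℚ) = sqClass (d₂ : ℚ)) : d₁ = d₂ := by
  have h0₁ : (d₁ : ℚ) ≠ 0 := by exact_mod_cast h₁.ne_zero
  have h0₂ : (d₂ : ℚ) ≠ 0 := by exact_mod_cast h₂.ne_zero
  have h1 : sqClass ((d₁ : ℚ) * d₂) = 1 := by rw [sqClass_mul h0₁ h0₂, he, SqUnits.mul_self]
  obtain ⟨u, hu⟩ := (sqClass_eq_one_iff (mul_ne_zero h0₁ h0₂)).mp h1
  obtain ⟨m, hm⟩ : IsSquare (d₁ * d₂) := by
    rw [← Rat.isSquare_intCast_iff]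
    exact ⟨u, by push_cast; rw [hu, pow_two]⟩
  exact eq_of_squarefree_of_mul_eq_sq h₁ h₂ (m := m) (by rw [hm, pow_two])

/-- Squarefreeness of an integer from the factorisation of its absolute value. [folklore] -/
private theorem squarefree_int_of_natAbs {d : ℤ} {n : ℕ} (h : d.natAbs = n) (hn : n ≠ 0)
    (hnd : n.primeFactorsList.Nodup) : Squarefree d :=
  Int.squarefree_natAbs.mp (h ▸ (Nat.squarefree_iff_nodup_primeFactorsList hn).mpr hnd)

/-- A rational solution of `y² = x³ + a x² + b x` with `x ≠ 0` puts `[x]` into `α(E_{a,b}(ℚ))`. [folklore] -/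
private theorem sqClass_mem_range_of_eq {a b x y : ℚ} [(⟨0, a, 0, b, 0⟩ : WeierstrassCurve ℚ).IsElliptic]
    (hy : y ^ 2 = x ^ 3 + a * x ^ 2 + b * x) (hx : x ≠ 0) :
    sqClass x ∈ Set.range (⟨0, a, 0, b, 0⟩ : WeierstrassCurve ℚ).xSqClass := by
  have hns : (⟨0, a, 0, b, 0⟩ : WeierstrassCurve ℚ).toAffine.Nonsingular x y := by
    refine Affine.equation_iff_nonsingular.mp ?_
    rw [Affine.equation_iff]
    show y ^ 2 + 0 * x * y + 0 * y = x ^ 3 + a * x ^ 2 + b * x + 0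
    linear_combination hy
  exact ⟨.some x y hns, xSqClass_some_of_ne_zero _ hx⟩

/-- `[x t²] = [x]` in `ℚ*/ℚ*²`. [folklore] -/
private theorem sqClass_mul_sq' {x t : ℚ} (hx : x ≠ 0) (ht : t ≠ 0) : sqClass (x * t ^ 2) = sqClass x := by
  rw [sqClass_mul hx (pow_ne_zero 2 ht), sqClass_sq, mul_one]

/-- A power of `2` exceeding `4` is at least `8`. [folklore] -/
private theorem eight_le_of_pow {m j : ℕ} (hm : m = 2 ^ j) (hlt : 4 < m) : 8 ≤ m := by
  subst hm
  have hj : 2 < j := (Nat.pow_lt_pow_iff_right Nat.one_lt_two).mp (by simpa using hlt)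
  exact le_trans (by norm_num) (Nat.pow_le_pow_right two_pos hj)

/-! ## §1 `#α(W(ℚ)) ≥ 6`: the points `(−64, 2104)`, `(−71, 2201)`, `(1031, 31961)` -/

/-- **`#α(W(ℚ)) ≥ 6` for `W : y² = x³ + x² − 73201x`**: `α(−64, 2104) = [−1]`, `α(−71, 2201) = [−71]`, `α(1031, 31961) = [1031]`,
whence also `[71]`, `[−1031]` and `[1]`. UNCONDITIONAL. [cite: SilvermanTate2015, §3.5–3.6 (α(x,y) = x mod ℚ*²)] -/
theorem natCard_range_xSqClass_W_ge :
    (Set.range (⟨0, 1, 0, -73201, 0⟩ : WeierstrassCurve ℚ).xSqClass).Finite ∧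
      6 ≤ Nat.card (Set.range (⟨0, 1, 0, -73201, 0⟩ : WeierstrassCurve ℚ).xSqClass) := by
  haveI := isElliptic_W
  set W := (⟨0, 1, 0, -73201, 0⟩ : WeierstrassCurve ℚ) with hW
  have hfin : (Set.range W.xSqClass).Finite := by
    have h := (natCard_range_xSqClass_le (a := 1) (b := -73201) hab).1
    rw [lit_W] at h
    exact h
  refine ⟨hfin, ?_⟩
  have mul : ∀ {x y : ℚ}, x ≠ 0 → y ≠ 0 → sqClass x ∈ Set.range W.xSqClass → sqClass y ∈ Set.range W.xSqClass →
      sqClass (x * y) ∈ Set.range W.xSqClass := by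
    intro x y hx hy h₁ h₂
    rw [sqClass_mul hx hy]
    exact mul_mem_range_xSqClass W h₁ h₂
  have g0 : sqClass (1 : ℚ) ∈ Set.range W.xSqClass :=
    ⟨0, by rw [xSqClass_zero]; exact ((sqClass_eq_one_iff one_ne_zero).mpr ⟨1, by norm_num⟩).symm⟩
  have gm1 : sqClass (-1 : ℚ) ∈ Set.range W.xSqClass := by
    have h := sqClass_mem_range_of_eq (a := 1) (b := -73201) (x := -64) (y := 2104) (by norm_num) (by norm_num)
    rwa [show (-64 : ℚ) = -1 * 8 ^ 2 by norm_num, sqClass_mul_sq' (by norm_num) (by norm_num)] at h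
  have gm71 : sqClass (-71 : ℚ) ∈ Set.range W.xSqClass :=
    sqClass_mem_range_of_eq (a := 1) (b := -73201) (x := -71) (y := 2201) (by norm_num) (by norm_num)
  have g1031 : sqClass (1031 : ℚ) ∈ Set.range W.xSqClass :=
    sqClass_mem_range_of_eq (a := 1) (b := -73201) (x := 1031) (y := 31961) (by norm_num) (by norm_num)
  have g71 : sqClass (71 : ℚ) ∈ Set.range W.xSqClass := by
    have h := mul (by norm_num) (by norm_num) gm1 gm71; norm_num at h; exact h
  have gm1031 : sqClass (-1031 : ℚ) ∈ Set.range W.xSqClass := by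
    have h := mul (by norm_num) (by norm_num) gm1 g1031; norm_num at h; exact h
  set C : Finset ℤ := {1, -1, 71, -71, 1031, -1031} with hC
  have hsqf : ∀ d ∈ C, Squarefree d := by
    intro d hd
    simp only [hC, Finset.mem_insert, Finset.mem_singleton] at hd
    rcases hd with rfl | rfl | rfl | rfl | rfl | rfl
    · exact squarefree_int_of_natAbs (n := 1) rfl one_ne_zero (by simp)
    · exact squarefree_int_of_natAbs (n := 1) rfl one_ne_zero (by simp)
    · exact squarefree_int_of_natAbs (n := 71) rfl (by norm_num) (by simp)
    · exact squarefree_int_of_natAbs (n := 71) rfl (by norm_num) (by simp)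
    · exact squarefree_int_of_natAbs (n := 1031) rfl (by norm_num) (by simp)
    · exact squarefree_int_of_natAbs (n := 1031) rfl (by norm_num) (by simp)
  have hsub : (↑(C.image fun d : ℤ => sqClass (d : ℚ)) : Set (SqUnits ℚ)) ⊆ Set.range W.xSqClass := by
    intro c hc
    obtain ⟨d, hd, rfl⟩ := Finset.mem_image.mp (Finset.mem_coe.mp hc)
    simp only [hC, Finset.mem_insert, Finset.mem_singleton] at hd
    rcases hd with rfl | rfl | rfl | rfl | rfl | rfl <;> push_cast
    · exact g0
    · exact gm1
    · exact g71
    · exact gm71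
    · exact g1031
    · exact gm1031
  have hcard : (C.image fun d : ℤ => sqClass (d : ℚ)).card = 6 := by
    rw [Finset.card_image_of_injOn (fun d₁ h₁ d₂ h₂ he => eq_of_sqClass_intCast_eq (hsqf d₁ h₁) (hsqf d₂ h₂) he)]
    rfl
  calc 6 = (↑(C.image fun d : ℤ => sqClass (d : ℚ)) : Set (SqUnits ℚ)).ncard := by rw [Set.ncard_coe_finset, hcard]
    _ ≤ (Set.range W.xSqClass).ncard := Set.ncard_le_ncard hsub hfin
    _ = Nat.card (Set.range W.xSqClass) := (Nat.card_coe_set_eq _).symm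

/-! ## §2 `#ᾱ(W'(ℚ)) ≥ 5`: the points `(5, 1210)`, `(2512, 128740)`, `(373, 12682)` -/

/-- **`#ᾱ(W'(ℚ)) ≥ 5` for `W' : y² = x³ − 2x² + 292805x`**: `ᾱ(5, 1210) = [5]`, `ᾱ(2512, 128740) = [157]` (`2512 = 157·4²`),
`ᾱ(373, 12682) = [373]`, whence also `[785] = [5·157]` and `[1]`. UNCONDITIONAL. [cite: SilvermanTate2015, §3.5–3.6 (ᾱ on Γ̄)] -/
theorem natCard_range_xSqClass_W'_ge :
    (Set.range (⟨0, -2, 0, 292805, 0⟩ : WeierstrassCurve ℚ).xSqClass).Finite ∧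
      5 ≤ Nat.card (Set.range (⟨0, -2, 0, 292805, 0⟩ : WeierstrassCurve ℚ).xSqClass) := by
  haveI := isElliptic_W'
  set W := (⟨0, -2, 0, 292805, 0⟩ : WeierstrassCurve ℚ) with hW
  have hfin : (Set.range W.xSqClass).Finite := by
    have h := (natCard_range_xSqClass_le (a := -2 * 1) (b := (1 : ℤ) ^ 2 - 4 * (-73201))
      (twoIsogenyCodomain_ne_zero hab)).1
    rw [lit_W'] at h
    exact h
  refine ⟨hfin, ?_⟩
  have mul : ∀ {x y : ℚ}, x ≠ 0 → y ≠ 0 → sqClass x ∈ Set.range W.xSqClass → sqClass y ∈ Set.range W.xSqClass →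
      sqClass (x * y) ∈ Set.range W.xSqClass := by
    intro x y hx hy h₁ h₂
    rw [sqClass_mul hx hy]
    exact mul_mem_range_xSqClass W h₁ h₂
  have g0 : sqClass (1 : ℚ) ∈ Set.range W.xSqClass :=
    ⟨0, by rw [xSqClass_zero]; exact ((sqClass_eq_one_iff one_ne_zero).mpr ⟨1, by norm_num⟩).symm⟩
  have g5 : sqClass (5 : ℚ) ∈ Set.range W.xSqClass :=
    sqClass_mem_range_of_eq (a := -2) (b := 292805) (x := 5) (y := 1210) (by norm_num) (by norm_num)
  have g157 : sqClass (157 : ℚ) ∈ Set.range W.xSqClass := by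
    have h := sqClass_mem_range_of_eq (a := -2) (b := 292805) (x := 2512) (y := 128740) (by norm_num) (by norm_num)
    rwa [show (2512 : ℚ) = 157 * 4 ^ 2 by norm_num, sqClass_mul_sq' (by norm_num) (by norm_num)] at h
  have g373 : sqClass (373 : ℚ) ∈ Set.range W.xSqClass :=
    sqClass_mem_range_of_eq (a := -2) (b := 292805) (x := 373) (y := 12682) (by norm_num) (by norm_num)
  have g785 : sqClass (785 : ℚ) ∈ Set.range W.xSqClass := by
    have h := mul (by norm_num) (by norm_num) g5 g157; norm_num at h; exact h
  set C : Finset ℤ := {1, 5, 157, 373, 785} with hC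
  have hsqf : ∀ d ∈ C, Squarefree d := by
    intro d hd
    simp only [hC, Finset.mem_insert, Finset.mem_singleton] at hd
    rcases hd with rfl | rfl | rfl | rfl | rfl
    · exact squarefree_int_of_natAbs (n := 1) rfl one_ne_zero (by simp)
    · exact squarefree_int_of_natAbs (n := 5) rfl (by norm_num) (by simp)
    · exact squarefree_int_of_natAbs (n := 157) rfl (by norm_num) (by simp)
    · exact squarefree_int_of_natAbs (n := 373) rfl (by norm_num) (by simp)
    · exact squarefree_int_of_natAbs (n := 785) rfl (by norm_num) (by simp)
  have hsub : (↑(C.image fun d : ℤ => sqClass (d : ℚ)) : Set (SqUnits ℚ)) ⊆ Set.range W.xSqClass := by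
    intro c hc
    obtain ⟨d, hd, rfl⟩ := Finset.mem_image.mp (Finset.mem_coe.mp hc)
    simp only [hC, Finset.mem_insert, Finset.mem_singleton] at hd
    rcases hd with rfl | rfl | rfl | rfl | rfl <;> push_cast
    · exact g0
    · exact g5
    · exact g157
    · exact g373
    · exact g785
  have hcard : (C.image fun d : ℤ => sqClass (d : ℚ)).card = 5 := by
    rw [Finset.card_image_of_injOn (fun d₁ h₁ d₂ h₂ he => eq_of_sqClass_intCast_eq (hsqf d₁ h₁) (hsqf d₂ h₂) he)]
    rfl
  calc 5 = (↑(C.image fun d : ℤ => sqClass (d : ℚ)) : Set (SqUnits ℚ)).ncard := by rw [Set.ncard_coe_finset, hcard]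
    _ ≤ (Set.range W.xSqClass).ncard := Set.ncard_le_ncard hsub hfin
    _ = Nat.card (Set.range W.xSqClass) := (Nat.card_coe_set_eq _).symm

/-! ## §3 The Selmer bound, `rank W(ℚ) = 4`, `Ш(W/ℚ)[2] = 0`, no CM -/

/-- **`dim₂ S(1,−73201) + dim₂ S(−2,292805) ≤ 6`**: `≤ ν(73201) + 1 = 3` plus `≤ ν(292805) = 3` (`b' > 0`, `a' = −2 ≤ 0`).
[cite: SilvermanAEC2009, Prop. X.4.9 and Example X.4.10] -/
theorem twoIsogenySelmerRank_add_le :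
    twoIsogenySelmerRank 1 (-73201) + twoIsogenySelmerRank' 1 (-73201) ≤ 6 := by
  have h1 : twoIsogenySelmerRank 1 (-73201) ≤ 3 := by
    have h := XCubeAddDX.twoIsogenySelmerRank_le (a := 1) (b := -73201) (by norm_num)
    have hw : (-73201 : ℤ).natAbs.primeFactors.card = 2 := by
      rw [show (-73201 : ℤ).natAbs = 73201 from rfl]; simp [Nat.primeFactors]
    rwa [hw] at h
  have h2 : twoIsogenySelmerRank' 1 (-73201) ≤ 3 := by
    have e : twoIsogenySelmerRank' 1 (-73201) = twoIsogenySelmerRank (-2) 292805 := by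
      show twoIsogenySelmerRank (-2 * 1) ((1 : ℤ) ^ 2 - 4 * (-73201)) = twoIsogenySelmerRank (-2) 292805
      norm_num
    rw [e]
    have h := twoIsogenySelmerRank_le_of_pos (a := -2) (b := 292805) (by norm_num) (by norm_num)
    have hw : (292805 : ℤ).natAbs.primeFactors.card = 3 := by
      rw [show (292805 : ℤ).natAbs = 292805 from rfl]; simp [Nat.primeFactors]
    rwa [hw] at h
  omega

/-- **`rank W(ℚ) = 4` for `W : y² = x³ + x² − 73201x`**, UNCONDITIONALLY: `#α · #ᾱ = 2^{rank+2}` with both factors powers of `2`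
(`≥ 6`, `≥ 5`, hence `≥ 8` each), so `rank + 2 ≥ 6`; and `rank + 2 ≤ dim₂ S + dim₂ S' ≤ 6`
(tree `twoIsogeny_mordellWeilRank_add_two_le_holds`). [cite: SilvermanTate2015, §3.6 (2^r = #α(Γ)·#ᾱ(Γ̄)/4)] -/
theorem mordellWeilRank_eq_four : (⟨0, 1, 0, -73201, 0⟩ : WeierstrassCurve ℚ).mordellWeilRank = 4 := by
  haveI hE := isElliptic_mk_of_ne_zero (F := ℚ) hab
  have key := natCard_range_xSqClass_mul (⟨0, ((1 : ℤ) : ℚ), 0, ((-73201 : ℤ) : ℚ), 0⟩ : WeierstrassCurve ℚ)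
  rw [twoIsogenyCodomain_mk_intCast 1 (-73201 : ℤ), lit_W', lit_W] at key
  obtain ⟨-, h6⟩ := natCard_range_xSqClass_W_ge
  obtain ⟨-, h5⟩ := natCard_range_xSqClass_W'_ge
  set A := Nat.card (Set.range (⟨0, 1, 0, -73201, 0⟩ : WeierstrassCurve ℚ).xSqClass) with hA
  set A' := Nat.card (Set.range (⟨0, -2, 0, 292805, 0⟩ : WeierstrassCurve ℚ).xSqClass) with hA'
  set r := (⟨0, 1, 0, -73201, 0⟩ : WeierstrassCurve ℚ).mordellWeilRank with hr
  obtain ⟨j, -, hj⟩ := (Nat.dvd_prime_pow Nat.prime_two).mp (Dvd.intro _ key : A ∣ 2 ^ (r + 2))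
  obtain ⟨j', -, hj'⟩ := (Nat.dvd_prime_pow Nat.prime_two).mp (Dvd.intro_left _ key : A' ∣ 2 ^ (r + 2))
  have h8 : 8 ≤ A := eight_le_of_pow hj (by omega)
  have h8' : 8 ≤ A' := eight_le_of_pow hj' (by omega)
  have h64 : 2 ^ 6 ≤ 2 ^ (r + 2) := by
    rw [← key]
    exact le_trans (by norm_num) (Nat.mul_le_mul h8 h8')
  have hge : 6 ≤ r + 2 := (Nat.pow_le_pow_iff_right Nat.one_lt_two).mp h64
  have hle := twoIsogeny_mordellWeilRank_add_two_le_holds 1 (-73201) hab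
  rw [lit_W] at hle
  have h6' := twoIsogenySelmerRank_add_le
  omega

/-- **`Ш(W/ℚ)[2] = 0` for `W : y² = x³ + x² − 73201x`**, UNCONDITIONALLY: the descent is sharp (`dim₂ S + dim₂ S' ≤ 6 = rank + 2`),
tree `forall_mem_sha_two_smul_eq_zero_of_selmerRank_add_le` (Silverman X.4.7). [cite: SilvermanAEC2009, Prop. X.4.7 and Thm. X.4.2(a)] -/
theorem forall_mem_sha_two_smul_eq_zero :
    ∀ c ∈ (⟨0, 1, 0, -73201, 0⟩ : WeierstrassCurve ℚ).sha, 2 • c = 0 → c = 0 := by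
  haveI := isElliptic_halfModel hab
  haveI := isElliptic_mk_of_ne_zero (F := ℚ) hab
  have hle : twoIsogenySelmerRank 1 (-73201) + twoIsogenySelmerRank' 1 (-73201) ≤
      (⟨0, ((1 : ℤ) : ℚ), 0, ((-73201 : ℤ) : ℚ), 0⟩ : WeierstrassCurve ℚ).mordellWeilRank + 2 := by
    rw [lit_W, mordellWeilRank_eq_four]
    exact twoIsogenySelmerRank_add_le
  have h := forall_mem_sha_two_smul_eq_zero_of_selmerRank_add_le hab hle
  have transfer : ∀ {W₁ W₂ : WeierstrassCurve ℚ} (_ : W₁ = W₂),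
      (∀ c ∈ W₁.sha, 2 • c = 0 → c = 0) → ∀ c ∈ W₂.sha, 2 • c = 0 → c = 0 := by
    intro W₁ W₂ e h₁
    subst e
    exact h₁
  exact transfer lit_W h

/-- **The NON-CM door at 2 at rank 4: `rank W(ℚ) = 4` and `t_2(W) = 0`** for `W : y² = x³ + x² − 73201x`. UNCONDITIONAL.
[cite: SilvermanAEC2009, Prop. X.4.7 and X.4.9] [cite: Greenberg1999LNM, §1] -/
theorem door_at_two_rank_four :
    (⟨0, 1, 0, -73201, 0⟩ : WeierstrassCurve ℚ).mordellWeilRank = 4 ∧ (⟨0, 1, 0, -73201, 0⟩ : WeierstrassCurve ℚ).shaCorank 2 = 0 :=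
  haveI : Fact (Nat.Prime 2) := ⟨Nat.prime_two⟩
  ⟨mordellWeilRank_eq_four,
    (⟨0, 1, 0, -73201, 0⟩ : WeierstrassCurve ℚ).shaCorank_eq_zero_of_forall 2 forall_mem_sha_two_smul_eq_zero⟩

/-- **`corank_{ℤ_2} Sel_{2^∞}(W/ℚ) = 4 = rank W(ℚ)`** for `W : y² = x³ + x² − 73201x`. UNCONDITIONAL. [cite: Greenberg1999LNM, §1 pp. 54–57] -/
theorem selmerCorank_two_eq_four : (⟨0, 1, 0, -73201, 0⟩ : WeierstrassCurve ℚ).selmerCorank 2 = 4 := by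
  haveI := isElliptic_W
  haveI : Fact (Nat.Prime 2) := ⟨Nat.prime_two⟩
  rw [(⟨0, 1, 0, -73201, 0⟩ : WeierstrassCurve ℚ).selmerCorank_eq_mordellWeilRank_add_holds 2,
    door_at_two_rank_four.1, door_at_two_rank_four.2]

/-- **O holds for `W : y² = x³ + x² − 73201x`** (rank 4, non-CM), witness `p₀ = 2`. UNCONDITIONAL. [cite: Greenberg1999LNM, §1] -/
theorem oneFiniteShaComponent_W :
    ∃ (q : ℕ) (_ : Fact q.Prime), (⟨0, 1, 0, -73201, 0⟩ : WeierstrassCurve ℚ).shaCorank q = 0 :=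
  ⟨2, ⟨Nat.prime_two⟩, door_at_two_rank_four.2⟩

/-- **`W : y² = x³ + x² − 73201x` has NO complex multiplication**: `j(W) = 3513664³/25103397282316880 ∉ ℤ` (`W` has multiplicative
reduction at `5, 71, 157, 373, 1031`), while CM `j`-invariants over `ℚ` are integers (tree `exists_intCast_eq_j_of_hasCM`).
[cite: SilvermanATAEC1994, Thm. II.6.1] -/
theorem not_hasCM : ¬ (⟨0, 1, 0, -73201, 0⟩ : WeierstrassCurve ℚ).HasCM := by
  haveI := isElliptic_W
  intro hCM
  obtain ⟨n, hn⟩ := (⟨0, 1, 0, -73201, 0⟩ : WeierstrassCurve ℚ).exists_intCast_eq_j_of_hasCM hCM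
  have hΔ : (⟨0, 1, 0, -73201, 0⟩ : WeierstrassCurve ℚ).Δ = 25103397282316880 := by
    norm_num [WeierstrassCurve.Δ, WeierstrassCurve.b₂, WeierstrassCurve.b₄, WeierstrassCurve.b₆, WeierstrassCurve.b₈]
  have hc₄ : (⟨0, 1, 0, -73201, 0⟩ : WeierstrassCurve ℚ).c₄ = 3513664 := by
    norm_num [WeierstrassCurve.c₄, WeierstrassCurve.b₂, WeierstrassCurve.b₄]
  rw [WeierstrassCurve.j, Units.val_inv_eq_inv_val, WeierstrassCurve.coe_Δ', hΔ, hc₄] at hn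
  have h' : (n : ℚ) * 25103397282316880 = 3513664 ^ 3 := by rw [hn]; norm_num
  have h'' : n * 25103397282316880 = 3513664 ^ 3 := by exact_mod_cast h'
  omega

/-- **A NON-CM rank-4 instance of T's hypothesis**: an elliptic `E/ℚ` without CM, of rank `4`, with `t_2(E) = 0` and
`corank Sel_{2^∞}(E) = 4`. UNCONDITIONAL. [cite: Greenberg1999LNM, §1] -/
theorem exists_nonCM_door_at_two_rank_four :
    ∃ W : WeierstrassCurve ℚ, W.IsElliptic ∧ ¬ W.HasCM ∧ W.mordellWeilRank = 4 ∧ W.selmerCorank 2 = 4 ∧ W.shaCorank 2 = 0 :=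
  ⟨_, isElliptic_W, not_hasCM, door_at_two_rank_four.1, selmerCorank_two_eq_four, door_at_two_rank_four.2⟩

end Summit.BirchSwinnertonDyer.BirchSwinnertonDyer.Theorems.ShaPrimaryTransferNonCMRankFour

end
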